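import Mathlib
import HarnessLib
import Literature.Computability.MetaComplexity.NCIPSFormulaCertificate

/-!
# Crux `RankDefectRepresentations` (stmt-PneNP-18923), line `rank-dehn-ladder`, stub `stub_tseitinTransfer`: DEFINITIONS

The registered stub `stub_tseitinTransfer` (Boolean-certificate transfer in the rank metric) says: for an
almost-representation `M` on `n` letters and a propositional TAUTOLOGY `T` with `n + size T ≤ N`, the rank of LTW's
translation `tr T` at `M` is polynomially dominated by the clause-product rank of an unsatisfiable CNF on `N` variables at an
almost-representation `M'` on `N` letters.  The witnesses are the TSEITIN CNF of `T` [Tseitin1968] and the EXTENSION of `M`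
by the truth-value matrices of the subformulas of `T`; this file only DEFINES them (proofs in the companion files
`…TseitinTransferCnf`, `…TseitinTransferRank`, `…TseitinTransfer`):

* `tseitinClauses n g k` — the Tseitin clauses of `g : PropForm (Fin n)` over `ℕ`-indexed variables, the nodes of `g` being
  numbered in PREORDER starting at `n + k` (original variables keep their index `< n`; a node `conj a b` at `n + k` has its
  children at `n + (k+1)` and `n + (k+1+size a)`); clauses `y ↔ x_i`, `y ↔ b`, `y ↔ ¬y₁`, `y ↔ y₁ ∧ y₂`, `y ↔ y₁ ∨ y₂`
  in the usual two- or three-literal clause form, literals `(v, true)` positive (the tree's `Literal` convention);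
* `tseitinNat n T` — all node clauses of `T` (root at `n`) followed by the unit clause `¬y_root` (LAST);
* `tseitinCNF n N hN T` — the same CNF transported to `Fin N` along `m ↦ m % N` (the identity on the indices used when
  `n + T.size ≤ N`);
* `subAt g k` — the subformula occurrence of `g` at preorder position `k` (`none` past the end);
* `nodeMat K M T k` — the TRUTH-VALUE MATRIX `1 − tr(T_k)(M)` of the subformula at position `k` (`0` past the end), where
  `tr` is `Literature.Computability.MetaComplexity.NCIPS.tr` (value `0` = true at 0/1 points, so `1 − tr` is the truth value);
* `extNat K M T` / `extTuple K M T N` — the extended tuple: variable `i < n ↦ M i`, variable `n + k ↦ nodeMat K M T k`,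
  read on `ℕ` resp. on `Fin N`.
HONEST FRAMING: bookkeeping for a provable rung of the ladder; P ≠ NP is not moved; F-N2 is a FRONTIER formal rung.
-/

set_option linter.dupNamespace false -- `Summit.PneNP.PneNP.…`: summit = sub-problem name (D-0017)

namespace Summit.PneNP.PneNP.Theorems.CnfIdealGenLengthRankDefectRepresentationsTseitinTransfer

open Literature.Computability.Complexity
open Literature.Computability.MetaComplexity
open Literature.Computability.MetaComplexity.NCIPS

/-- The Tseitin clauses of `g` with its nodes numbered in preorder from `n + k` (children of a binary node at `n+(k+1)` and
`n+(k+1+size(left))`); each clause says "node value = connective of the children's values" in CNF.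
[cite: Tseitin1968, §1 (the extension rule / auxiliary variables for subformulas)] -/
def tseitinClauses (n : ℕ) : PropForm (Fin n) → ℕ → CNF ℕ
  | .var i, k => [[(n + k, false), ((i : ℕ), true)], [(n + k, true), ((i : ℕ), false)]]
  | .const true, k => [[(n + k, true)]]
  | .const false, k => [[(n + k, false)]]
  | .neg g, k => [[(n + k, false), (n + (k + 1), false)], [(n + k, true), (n + (k + 1), true)]] ++
      tseitinClauses n g (k + 1)
  | .conj a b, k =>
      [[(n + k, false), (n + (k + 1), true)], [(n + k, false), (n + (k + 1 + a.size), true)],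
        [(n + k, true), (n + (k + 1), false), (n + (k + 1 + a.size), false)]] ++
      tseitinClauses n a (k + 1) ++ tseitinClauses n b (k + 1 + a.size)
  | .disj a b, k =>
      [[(n + k, false), (n + (k + 1), true), (n + (k + 1 + a.size), true)], [(n + k, true), (n + (k + 1), false)],
        [(n + k, true), (n + (k + 1 + a.size), false)]] ++
      tseitinClauses n a (k + 1) ++ tseitinClauses n b (k + 1 + a.size)

/-- The Tseitin CNF of `T` over `ℕ`-indexed variables: all node clauses (root numbered `n`) and, LAST, the unit clause
`¬y_root`.  Unsatisfiable exactly when `T` is a tautology (proved in `…TseitinTransferCnf`). [cite: Tseitin1968, §1] -/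
def tseitinNat (n : ℕ) (T : PropForm (Fin n)) : CNF ℕ :=
  tseitinClauses n T 0 ++ [[(n, false)]]

/-- The Tseitin CNF of `T` on the variable set `Fin N`, transported along `m ↦ m % N` (the identity on every index that
occurs when `n + T.size ≤ N`). [cite: Tseitin1968, §1] -/
def tseitinCNF (n N : ℕ) (hN : 0 < N) (T : PropForm (Fin n)) : CNF (Fin N) :=
  (tseitinNat n T).map fun κ => κ.map fun l => (⟨l.1 % N, Nat.mod_lt _ hN⟩, l.2)

/-- The subformula occurrence at preorder position `k` (`subAt g 0 = some g`; the children of a binary node at position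
`p` sit at `p + 1` and `p + 1 + size(left)`; `none` when `k ≥ size g`). [folklore] -/
def subAt {ν : Type*} : PropForm ν → ℕ → Option (PropForm ν)
  | g, 0 => some g
  | .var _, _ + 1 => none
  | .const _, _ + 1 => none
  | .neg g, k + 1 => subAt g k
  | .conj a b, k + 1 => if k < a.size then subAt a k else subAt b (k - a.size)
  | .disj a b, k + 1 => if k < a.size then subAt a k else subAt b (k - a.size)

variable (K : Type) [Field K] {n d : ℕ}

/-- The truth-value matrix of the subformula of `T` at preorder position `k` under the matrix tuple `M`:
`1 − tr(T_k)(M)` (`tr` takes the value `0` at satisfying 0/1 points, so `1 − tr` is the truth value); `0` past the end.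
[cite: LiTzameretWang2018, Def. 1.3 (tr)] -/
noncomputable def nodeMat (M : Fin n → Matrix (Fin d) (Fin d) K) (T : PropForm (Fin n)) (k : ℕ) :
    Matrix (Fin d) (Fin d) K :=
  match subAt T k with
  | some g => 1 - MonoidAlgebra.lift K (Matrix (Fin d) (Fin d) K) (FreeMonoid (Fin n)) (FreeMonoid.lift M) (tr K g)
  | none => 0

/-- The extended tuple read on `ℕ`: an original variable `i < n` goes to `M i`, the node variable `n + k` to the truth-value
matrix `nodeMat K M T k`. [folklore] -/
noncomputable def extNat (M : Fin n → Matrix (Fin d) (Fin d) K) (T : PropForm (Fin n)) (m : ℕ) :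
    Matrix (Fin d) (Fin d) K :=
  if h : m < n then M ⟨m, h⟩ else nodeMat K M T (m - n)

/-- The extended tuple on `Fin N` (the almost-representation `M'` of the stub). [folklore] -/
noncomputable def extTuple (M : Fin n → Matrix (Fin d) (Fin d) K) (T : PropForm (Fin n)) (N : ℕ) :
    Fin N → Matrix (Fin d) (Fin d) K :=
  fun v => extNat K M T v.val

/-! ### Unfolding lemmas -/

/-- Position `0` is the formula itself. [folklore] -/
@[simp] theorem subAt_zero {ν : Type*} (g : PropForm ν) : subAt g 0 = some g := by
  cases g <;> rfl

/-- Positions inside a negation. [folklore] -/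
@[simp] theorem subAt_neg_succ {ν : Type*} (g : PropForm ν) (k : ℕ) : subAt (.neg g) (k + 1) = subAt g k := rfl

/-- Positions inside a conjunction. [folklore] -/
@[simp] theorem subAt_conj_succ {ν : Type*} (a b : PropForm ν) (k : ℕ) :
    subAt (.conj a b) (k + 1) = if k < a.size then subAt a k else subAt b (k - a.size) := rfl

/-- Positions inside a disjunction. [folklore] -/
@[simp] theorem subAt_disj_succ {ν : Type*} (a b : PropForm ν) (k : ℕ) :
    subAt (.disj a b) (k + 1) = if k < a.size then subAt a k else subAt b (k - a.size) := rfl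

/-- A variable has no proper positions. [folklore] -/
@[simp] theorem subAt_var_succ {ν : Type*} (i : ν) (k : ℕ) : subAt (.var i) (k + 1) = none := rfl

/-- A constant has no proper positions. [folklore] -/
@[simp] theorem subAt_const_succ {ν : Type*} (b : Bool) (k : ℕ) : subAt (.const b : PropForm ν) (k + 1) = none := rfl

/-- Original variables are read from `M`. [folklore] -/
theorem extNat_lt (M : Fin n → Matrix (Fin d) (Fin d) K) (T : PropForm (Fin n)) (i : Fin n) :
    extNat K M T i = M i := by
  simp [extNat, i.isLt]

/-- Node variables are read from `nodeMat`. [folklore] -/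
theorem extNat_node (M : Fin n → Matrix (Fin d) (Fin d) K) (T : PropForm (Fin n)) (k : ℕ) :
    extNat K M T (n + k) = nodeMat K M T k := by
  simp [extNat]

end Summit.PneNP.PneNP.Theorems.CnfIdealGenLengthRankDefectRepresentationsTseitinTransfer
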